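import Mathlib
import Literature.NumberTheory.LFunctions.Zhang2022.TypedSection14
import Literature.NumberTheory.LFunctions.Zhang2022.Section14GaussSums
import Literature.NumberTheory.LFunctions.Zhang2022.Section14Summability
import HarnessLib

/-!
# Zhang (2022), §14: kernel proofs over the typed statements of `TypedSection14.lean`

Topic `Literature/NumberTheory/LFunctions/Zhang2022` (Landau–Siegel audit tree; verdict-neutral).
Y. Zhang, *Discrete mean estimates and the Landau–Siegel zero*, arXiv:2211.02515v1 (2022)
[Zhang2022LandauSiegel] — an unrefereed manuscript under adjudication; **nothing here asserts or denies
its Theorems 1–2.** This theorem-only companion of `TypedSection14.lean` (namespace `…Typed.Sec14`)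
kernel-checks, with NO hypothesis beyond "`D` large" and NO new definitions:

* `eq147_holds : Eq147` — **(14.7)** (p. 78, tex L3924), the expansion of `𝒮(1,D;p)` in the characters
  `θ (mod Dk)`: termwise the orthogonality identity u012 (`step14u012_holds`), with `(p,Dk) = 1` because
  `k ≤ 2P₄ < P < p` and `D < P < p` for `D ≥ ⌈exp(2·260⁵²⁰)⌉` (`sizes_of_large`: `2t₀ < e^{2𝓛} ≤ T²`);
  the interchange of `Σ_l` and `Σ_θ` is justified when the series converge absolutely and is trivial
  otherwise (`|θ(−l)| = 𝟙_{(l,Dk)=1}`, so either every series converges absolutely or every one is `0`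
  in Mathlib's `tsum` convention) — `twisted_series_eq`;
* `step14u015_of_u014 : Step14u014 → Step14u015` — the EDGE from u014 (`τ(θ_k¹)θ_k¹(p)θ_k¹(−l) =
  τ(χ)μχ(k)χ(−pl)`, held by another seat) to u015 (p. 78, tex L3938): `φ(Dk) = φ(D)φ(k)` for `(D,k) = 1`,
  `χ(k) = 0` otherwise, `χ(−pl) = χ(−p)χ(l)` and `𝟙_{(l,Dk)=1}χ(l) = 𝟙_{(l,k)=1}χ(l)`.

* `step14u015_holds : Step14u015`, `eq144_of_u006b : Step14u006b → Eq144` — compositions with the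
  Gauss-sum leaves `step14u014_holds`, `eq144_of_u008_u006b` of `Section14GaussSums` (another seat's).
* `step14u006b_of_u006a : Step14u006a → Step14u006b` — the EDGE between the two lines of u006 (p. 77,
  tex L3866–3871): the substitution `d = (m,n)`, `m = dl`, `n = dk` as an exact regrouping
  (`sum_u006_regroup`) of the absolutely convergent double sum (absolute convergence from (14.1) and the
  decay of `Δ`, `Section14Summability.summable_kappa_mul_DeltaW`, another seat's); `(dDk, p) = 1` because
  `d, k ≤ 2P₄ < P < p` and `p ∤ D` (`Section14GaussSums`), so `e(dl·\overline{D·dk}/p) = e(l·\overline{Dk}/p)`.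

Deliberately NOT here: u013 (the principal-character bound needs the decay of `Δ`, Lemma 5.3, for the
absolute convergence of `Σ_l |κ*(dl)Δ(l/(Dpk))|`), (14.5)/(14.8) (claims; edges `DedEq145`, `eq148_of_legs`).

## References

* Y. Zhang, arXiv:2211.02515v1 (2022), §14 pp. 78–79, (14.7), u012–u015. [cite: Zhang2022LandauSiegel, §14]
-/

noncomputable section

open Complex Real ComplexConjugate

namespace Literature.NumberTheory.LFunctions.Zhang2022.Typed.Sec14

open Skeleton

/-! ## Helpers -/

/-- `‖e(y)‖ = 1`. [folklore] -/
private theorem norm_eAdd (y : ℝ) : ‖eAdd y‖ = 1 := by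
  rw [eAdd, show (2 * π * I * (y : ℂ)) = ((2 * π * y : ℝ) : ℂ) * I by push_cast; ring]
  exact Complex.norm_exp_ofReal_mul_I _

/-- `‖θ(−l)‖ = 1` if `(l,N) = 1` and `θ(−l) = 0` otherwise, for a character `θ (mod N)`. [folklore] -/
private theorem norm_char_neg_natCast {N : ℕ} (θ : DirichletCharacter ℂ N) (l : ℕ) :
    ‖θ (-(l : ZMod N))‖ = if Nat.Coprime l N then 1 else 0 := by
  by_cases h : Nat.Coprime l N
  · rw [if_pos h]
    obtain ⟨u, hu⟩ := ((ZMod.isUnit_iff_coprime l N).mpr h).neg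
    rw [← hu]
    exact θ.unit_norm_eq_one u
  · rw [if_neg h]
    have hu : ¬ IsUnit (-(l : ZMod N)) := fun h' =>
      h ((ZMod.isUnit_iff_coprime l N).mp ((IsUnit.neg_iff _).mp h'))
    rw [MulChar.map_nonunit θ hu, norm_zero]

/-- The `l`-series of (14.4)/(14.7) for one `k`: the twisted form `Σ_{(l,Dk)=1} κ*(dl)Δ_l e(−lp̄/(Dk))` equals
`φ(Dk)⁻¹ Σ_θ τ(θ̄)θ̄(p) Σ_l κ*(dl)θ(−l)Δ_l` — termwise by u012, the interchange of `Σ_l` and `Σ_θ` being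
justified when the series converge absolutely and trivial (both sides `0`) otherwise, since
`|θ(−l)| = 𝟙_{(l,Dk)=1}`. [cite: Zhang2022LandauSiegel, §14 (14.7) p.78, tex L3924] -/
private theorem twisted_series_eq {D k p : ℕ} (hD : 0 < D) (hk : 0 < k)
    (hp : Nat.Coprime p (D * k)) (κ : ℕ → ℂ) (Δ : ℕ → ℂ) :
    (∑' l : ℕ, if Nat.Coprime l (D * k) then
        κ l * Δ l * eAdd (-((l : ℝ) * nInv (D * k) p / (D * k))) else 0) =
      (Nat.totient (D * k) : ℂ)⁻¹ *
        ∑ θ ∈ finsetOf (Set.univ : Set (DirichletCharacter ℂ (D * k))),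
          tauSum (D * k) θ⁻¹ * θ⁻¹ (p : ZMod (D * k)) *
            ∑' l : ℕ, κ l * θ (-(l : ZMod (D * k))) * Δ l := by
  set N := D * k with hN
  set S := finsetOf (Set.univ : Set (DirichletCharacter ℂ N)) with hS
  set c : DirichletCharacter ℂ N → ℂ := fun θ => tauSum N θ⁻¹ * θ⁻¹ (p : ZMod N) with hc
  -- termwise identity (u012)
  have hterm : ∀ l : ℕ,
      (if Nat.Coprime l N then κ l * Δ l * eAdd (-((l : ℝ) * nInv N p / (D * k))) else 0) =
        (Nat.totient N : ℂ)⁻¹ * ∑ θ ∈ S, c θ * (κ l * θ (-(l : ZMod N)) * Δ l) := by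
    intro l
    by_cases hl : Nat.Coprime l N
    · rw [if_pos hl, step14u012_holds D k p l hD hk hl hp, ← hN, Finset.mul_sum, Finset.mul_sum,
        Finset.mul_sum]
      refine Finset.sum_congr rfl fun θ _ => ?_
      simp only [hc]
      ring
    · rw [if_neg hl]
      have h0 : ∀ θ ∈ S, c θ * (κ l * θ (-(l : ZMod N)) * Δ l) = 0 := by
        intro θ _
        have : θ (-(l : ZMod N)) = 0 := by
          have hn := norm_char_neg_natCast θ l
          rw [if_neg hl] at hn
          exact norm_eq_zero.mp hn
        rw [this]; ring
      rw [Finset.sum_congr rfl h0, Finset.sum_const_zero, mul_zero]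
  rw [tsum_congr hterm, tsum_mul_left]
  congr 1
  -- the majorant `H(l) = 𝟙_{(l,N)=1} ‖κ_l Δ_l‖`
  set H : ℕ → ℝ := fun l => if Nat.Coprime l N then ‖κ l * Δ l‖ else 0 with hH
  have hnorm : ∀ θ : DirichletCharacter ℂ N, ∀ l, ‖κ l * θ (-(l : ZMod N)) * Δ l‖ = H l := by
    intro θ l
    rw [norm_mul, norm_mul, norm_char_neg_natCast θ l, hH]
    by_cases hl : Nat.Coprime l N
    · simp only [if_pos hl, norm_mul]; ring
    · simp only [if_neg hl]; ring
  by_cases hsum : Summable H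
  · -- absolutely convergent: interchange the sums
    have hθ : ∀ θ ∈ S, Summable (fun l => c θ * (κ l * θ (-(l : ZMod N)) * Δ l)) := by
      intro θ _
      refine Summable.of_norm_bounded (hsum.mul_left ‖c θ‖) fun l => ?_
      rw [norm_mul, hnorm θ l]
    rw [Summable.tsum_finsetSum hθ]
    refine Finset.sum_congr rfl fun θ _ => ?_
    rw [tsum_mul_left]
  · -- not absolutely convergent: every series involved is `0`
    have hθ : ∀ θ : DirichletCharacter ℂ N, ¬ Summable (fun l => κ l * θ (-(l : ZMod N)) * Δ l) := by
      intro θ hθ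
      apply hsum
      have := summable_norm_iff.mpr hθ
      exact this.congr (hnorm θ)
    have hL : ¬ Summable (fun l => ∑ θ ∈ S, c θ * (κ l * θ (-(l : ZMod N)) * Δ l)) := by
      intro hsumL
      -- undo the termwise rewriting: this is the summability of the left side
      have h1 : Summable (fun l => (Nat.totient N : ℂ)⁻¹ *
          ∑ θ ∈ S, c θ * (κ l * θ (-(l : ZMod N)) * Δ l)) := hsumL.mul_left _
      have h2 : Summable (fun l : ℕ => if Nat.Coprime l N then
          κ l * Δ l * eAdd (-((l : ℝ) * nInv N p / (D * k))) else 0) := h1.congr fun l => (hterm l).symm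
      apply hsum
      have h3 := summable_norm_iff.mpr h2
      refine h3.congr fun l => ?_
      by_cases hl : Nat.Coprime l N
      · simp only [if_pos hl, hH, norm_mul, norm_eAdd, mul_one]
      · simp only [if_neg hl, hH, norm_zero]
    rw [tsum_eq_zero_of_not_summable hL, eq_comm]
    refine Finset.sum_eq_zero fun θ _ => ?_
    rw [tsum_eq_zero_of_not_summable (hθ θ), mul_zero]

/-- For `D ≥ D₁ := ⌈exp(2·260⁵²⁰)⌉`: `2P₄ < P` (`2t₀ = 2𝓛⁵¹⁹ < e^{2𝓛} ≤ T²`) and `D < P`, `1 ≤ 𝓛`. [folklore] -/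
private theorem sizes_of_large {D : ℕ} (hD : ⌈Real.exp (2 * 260 ^ 520)⌉₊ ≤ D) :
    2 * P4 D < bigP D ∧ (D : ℝ) < bigP D ∧ 1 ≤ ell D := by
  have hK1 : (1 : ℝ) ≤ 260 ^ 520 := one_le_pow₀ (by norm_num)
  generalize hK : (260 : ℝ) ^ 520 = K at *
  have hDpos : (0 : ℝ) < D := by
    have : (0 : ℝ) < ⌈Real.exp (2 * K)⌉₊ := by
      exact_mod_cast Nat.ceil_pos.mpr (Real.exp_pos _)
    exact this.trans_le (by exact_mod_cast hD)
  have hℓ : 2 * K ≤ ell D := by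
    rw [ell]
    have h1 : Real.exp (2 * K) ≤ D := le_trans (Nat.le_ceil _) (by exact_mod_cast hD)
    exact (Real.le_log_iff_exp_le hDpos).mpr h1
  have hK0 : 0 < K := lt_of_lt_of_le one_pos hK1
  have hℓ1 : 1 ≤ ell D := le_trans (by linarith only [hK1]) hℓ
  have hℓ0 : 0 < ell D := lt_of_lt_of_le one_pos hℓ1
  refine ⟨?_, ?_, hℓ1⟩
  · -- `2t₀ < T²`
    have hT2 : bigT D ^ 2 = Real.exp (2 * ell D ^ (1.1 : ℝ)) := by
      rw [bigT, ← Real.exp_nat_mul]; norm_num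
    have h11 : ell D ≤ ell D ^ (1.1 : ℝ) := by
      conv_lhs => rw [← Real.rpow_one (ell D)]
      exact Real.rpow_le_rpow_of_exponent_le hℓ1 (by norm_num)
    have hexp : (ell D / 260 + 1) ^ 520 ≤ Real.exp (2 * ell D) := by
      have h := Real.add_one_le_exp (ell D / 260)
      have h0 : 0 ≤ ell D / 260 + 1 := by linarith only [div_nonneg hℓ0.le (by norm_num : (0:ℝ) ≤ 260)]
      calc (ell D / 260 + 1) ^ 520 ≤ Real.exp (ell D / 260) ^ 520 := pow_le_pow_left₀ h0 h 520
        _ = Real.exp (2 * ell D) := by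
            rw [← Real.exp_nat_mul]
            congr 1
            push_cast
            ring
    have hpoly : 2 * t0 D < (ell D / 260 + 1) ^ 520 := by
      have h1 : (ell D / 260) ^ 520 < (ell D / 260 + 1) ^ 520 :=
        pow_lt_pow_left₀ (lt_add_one _) (div_nonneg hℓ0.le (by norm_num)) (by norm_num)
      have h2 : 2 * t0 D ≤ (ell D / 260) ^ 520 := by
        rw [t0, div_pow, hK, le_div_iff₀ hK0, mul_right_comm]
        calc 2 * K * ell D ^ 519 ≤ ell D * ell D ^ 519 := by gcongr
          _ = ell D ^ 520 := (pow_succ' (ell D) 519).symm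
      exact h2.trans_lt h1
    have hT : 2 * t0 D < bigT D ^ 2 := by
      rw [hT2]
      calc 2 * t0 D < (ell D / 260 + 1) ^ 520 := hpoly
        _ ≤ Real.exp (2 * ell D) := hexp
        _ ≤ Real.exp (2 * ell D ^ (1.1 : ℝ)) := Real.exp_le_exp.mpr (by linarith only [h11])
    have hP : 0 < bigP D := Real.exp_pos _
    have hTpos : 0 < bigT D ^ 2 := pow_pos (Real.exp_pos _) 2
    rw [P4]
    calc 2 * (bigP D / bigT D ^ 2 * t0 D) = bigP D * ((2 * t0 D) / bigT D ^ 2) := by ring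
      _ < bigP D * 1 := by
          gcongr
          rwa [div_lt_one hTpos]
      _ = bigP D := mul_one _
  · -- `D = e^𝓛 < e^{𝓛⁹} = P`
    have h9 : ell D < ell D ^ 9 := by
      have h2 : (2 : ℝ) ≤ ell D := le_trans (by linarith only [hK1]) hℓ
      calc ell D = ell D ^ 1 := (pow_one _).symm
        _ < ell D ^ 9 := pow_lt_pow_right₀ (by linarith only [h2]) (by norm_num)
    calc (D : ℝ) = Real.exp (ell D) := by rw [ell, Real.exp_log hDpos]
      _ < bigP D := by rw [bigP]; exact Real.exp_lt_exp.mpr h9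

/-- For `D` large and `p ∼ P`: `p` is coprime to `Dk` for every `1 ≤ k ≤ 2P₄` (`k ≤ 2P₄ < P < p`,
`D < P < p`, `p` prime). [cite: Zhang2022LandauSiegel, §14 u012 p.78] -/
private theorem coprime_p_Dk_of_large {D : ℕ} (hD : ⌈Real.exp (2 * 260 ^ 520)⌉₊ ≤ D) {p : ℕ}
    (hp : p ∈ primeWindow D) {k : ℕ} (hk : k ∈ Finset.Icc 1 ⌊2 * P4 D⌋₊) :
    Nat.Coprime p (D * k) := by
  obtain ⟨hP4, hDP, -⟩ := sizes_of_large hD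
  have hpr : p.Prime := (Finset.mem_filter.mp hp).2
  have hpP : bigP D < p := by
    have h1 := (Finset.mem_Ioo.mp (Finset.mem_filter.mp hp).1).1
    exact (Nat.lt_floor_add_one (bigP D)).trans_le (by exact_mod_cast h1)
  have hk1 := (Finset.mem_Icc.mp hk).1
  have hk2 : (k : ℝ) ≤ 2 * P4 D := by
    have := (Finset.mem_Icc.mp hk).2
    have h0 : 0 ≤ 2 * P4 D := by
      have : (1 : ℝ) ≤ k := by exact_mod_cast hk1
      by_contra hneg
      push Not at hneg
      have : ⌊2 * P4 D⌋₊ = 0 := Nat.floor_eq_zero.mpr (by linarith)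
      omega
    exact le_trans (by exact_mod_cast this) (Nat.floor_le h0)
  have hkp : k < p := by exact_mod_cast (hk2.trans_lt (hP4.trans hpP))
  have hDp : D < p := by exact_mod_cast (hDP.trans hpP)
  have hD0 : 0 < D := lt_of_lt_of_le (Nat.ceil_pos.mpr (Real.exp_pos _)) hD
  exact Nat.Coprime.mul_right
    ((Nat.Prime.coprime_iff_not_dvd hpr).mpr (Nat.not_dvd_of_pos_of_lt hD0 hDp))
    ((Nat.Prime.coprime_iff_not_dvd hpr).mpr (Nat.not_dvd_of_pos_of_lt hk1 hkp))

/-- `Z22:(14.7)` DISCHARGED — **(14.7) holds** for all `D ≥ ⌈exp(2·260⁵²⁰)⌉`, `p ∼ P` and all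
sequences: the character expansion of `𝒮(1,D;p)`, termwise by u012 (`(p,Dk) = 1` since `k ≤ 2P₄ < P < p`
and `D < P < p`), the order of summation being immaterial (absolutely convergent, or every series `0`).
[cite: Zhang2022LandauSiegel, §14 (14.7) p.78, tex L3924] -/
theorem eq147_holds : Eq147 := by
  intro B
  refine ⟨⌈Real.exp (2 * 260 ^ 520)⌉₊, fun D _ χ hD _ _ => ?_⟩
  intro p hp κs as _ _
  have hD0 : 0 < D := lt_of_lt_of_le (Nat.ceil_pos.mpr (Real.exp_pos _)) hD
  unfold calS
  rw [Finset.filter_true_of_mem (fun k _ => Nat.coprime_one_right k)]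
  refine Finset.sum_congr rfl fun d _ => ?_
  congr 1
  refine Finset.sum_congr rfl fun k hk => ?_
  have hk0 : 0 < k := (Finset.mem_Icc.mp hk).1
  have hcop := coprime_p_Dk_of_large hD hp hk
  have key := twisted_series_eq hD0 hk0 hcop (fun l => κs (d * l))
    (fun l => DeltaW D ((l : ℝ) / ((D : ℝ) * p * k)))
  beta_reduce at key
  simp only [one_mul]
  rw [key]
  ring

/-- `𝟙_{(l,Dk)=1} χ(l) = 𝟙_{(l,k)=1} χ(l)` for the character `χ (mod D)` (`χ(l) = 0` unless `(l,D) = 1`).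
[folklore] -/
private theorem ite_coprime_mul_char {D : ℕ} (χ : DirichletCharacter ℂ D) (k l : ℕ) (z : ℂ) :
    (if Nat.Coprime l (D * k) then χ (l : ZMod D) * z else 0) =
      (if Nat.Coprime l k then χ (l : ZMod D) * z else 0) := by
  by_cases hk : Nat.Coprime l k
  · by_cases hDl : Nat.Coprime l D
    · rw [if_pos (Nat.Coprime.mul_right hDl hk), if_pos hk]
    · have h0 : χ (l : ZMod D) = 0 :=
        MulChar.map_nonunit χ (mt (ZMod.isUnit_iff_coprime l D).mp hDl)
      rw [if_pos hk, h0, zero_mul]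
      split_ifs <;> rfl
  · rw [if_neg hk, if_neg (fun h => hk (Nat.Coprime.coprime_mul_left_right h))]

/-- **EDGE u014 ⇒ u015** (`Z22:§14.u015` from `Z22:§14.u014`): inserting `τ(θ_k¹)θ_k¹(p)θ_k¹(−l) =
τ(χ)μχ(k)χ(−pl)` termwise, `φ(Dk) = φ(D)φ(k)` for `(D,k) = 1` (and `χ(k) = 0` otherwise), and
`χ(−pl) = χ(−p)χ(l)`, for `D ≥ ⌈exp(2·260⁵²⁰)⌉` (so that `(p,Dk) = 1`). Kernel-checked bookkeeping;
composes with a discharge of `Step14u014`. [cite: Zhang2022LandauSiegel, §14 u015 p.78, tex L3938] -/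
theorem step14u015_of_u014 (h14 : Step14u014) : Step14u015 := by
  intro B
  refine ⟨⌈Real.exp (2 * 260 ^ 520)⌉₊, fun D _ χ hD _ hprim => ?_⟩
  intro p hp κs as _ _
  unfold mainSum14
  rw [Finset.mul_sum]
  refine Finset.sum_congr rfl fun d _ => ?_
  conv_rhs => rw [mul_left_comm, Finset.mul_sum]
  congr 1
  refine Finset.sum_congr rfl fun k hk => ?_
  have hk0 : 0 < k := (Finset.mem_Icc.mp hk).1
  have hcop := coprime_p_Dk_of_large hD hp hk
  -- the constants of the `k`-th term
  set C₁ : ℂ := as (d * k) / ((Nat.totient (D * k) : ℂ) * k) *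
    (GammaFactor.tau χ * (ArithmeticFunction.moebius k : ℂ) * χ (k : ZMod D) * χ (-(p : ZMod D)))
    with hC₁
  -- termwise: u014 and `χ(−pl) = χ(−p)χ(l)`
  have hterm : ∀ l : ℕ,
      (if Nat.Coprime l (D * k) then
          κs (d * l) * as (d * k) / ((Nat.totient (D * k) : ℂ) * k) *
            DeltaW D ((l : ℝ) / ((D : ℝ) * p * k)) *
              (tauSum (D * k) (thetaOne χ k) * thetaOne χ k (p : ZMod (D * k)) *
                thetaOne χ k (-(l : ZMod (D * k)))) else 0) =
        C₁ * (if Nat.Coprime l (D * k) then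
          χ (l : ZMod D) * (κs (d * l) * DeltaW D ((l : ℝ) / ((D : ℝ) * p * k))) else 0) := by
    intro l
    by_cases hl : Nat.Coprime l (D * k)
    · rw [if_pos hl, if_pos hl, h14 D χ hprim k p l hk0 hcop hl, hC₁]
      have : χ (-((p * l : ℕ) : ZMod D)) = χ (-(p : ZMod D)) * χ (l : ZMod D) := by
        rw [← map_mul]; push_cast; ring_nf
      rw [this]
      ring
    · rw [if_neg hl, if_neg hl, mul_zero]
  rw [tsum_congr hterm, tsum_mul_left]
  -- the two `l`-series agree
  have hser : (∑' l : ℕ, if Nat.Coprime l (D * k) then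
        χ (l : ZMod D) * (κs (d * l) * DeltaW D ((l : ℝ) / ((D : ℝ) * p * k))) else 0) =
      ∑' l : ℕ, if Nat.Coprime l k then
        χ (l : ZMod D) * κs (d * l) * DeltaW D ((l : ℝ) / ((D : ℝ) * p * k)) else 0 := by
    refine tsum_congr fun l => ?_
    rw [ite_coprime_mul_char χ k l]
    split_ifs
    · ring
    · rfl
  rw [hser, hC₁]
  -- the constants agree
  by_cases hDk : Nat.Coprime D k
  · rw [Nat.totient_mul hDk]
    push_cast
    ring
  · have h0 : χ (k : ZMod D) = 0 :=
      MulChar.map_nonunit χ (mt (ZMod.isUnit_iff_coprime k D).mp (fun h => hDk h.symm))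
    rw [h0]
    ring

/-! ## u015 and (14.4), composed with the Gauss-sum leaves of `Section14GaussSums` -/

/-- `Z22:§14.u015` DISCHARGED: **u015 holds** (for `D ≥ ⌈exp(2·260⁵²⁰)⌉`, `p ∼ P`, all sequences) — the
edge `step14u015_of_u014` composed with `step14u014_holds` (`Section14GaussSums`).
[cite: Zhang2022LandauSiegel, §14 u015 p.78, tex L3938] -/
theorem step14u015_holds : Step14u015 := step14u015_of_u014 step14u014_holds

/-- `Z22:(14.4)` ⇐ `Z22:§14.u006`: **(14.4) holds as soon as the second line of u006 does** — the edge
`eq144_of_u008_u006b` (`Section14GaussSums`) composed with `step14u008_holds` (`TypedSection14`).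
[cite: Zhang2022LandauSiegel, §14 (14.4) p.77, tex L3882] -/
theorem eq144_of_u006b (h6 : Step14u006b) : Eq144 := eq144_of_u008_u006b step14u008_holds h6

/-! ## u006: the second line from the first (the substitution `d = (m,n)`, `m = dl`, `n = dk`) -/

/-- `e(a/p) = e(b/p)` when `a ≡ b (mod p)`: `e(y) = exp(2πiy)` has period `1`. [folklore] -/
private theorem eAdd_div_eq_of_modEq {p a b : ℕ} (hp : 0 < p) (h : a ≡ b [MOD p]) :
    eAdd ((a : ℝ) / p) = eAdd ((b : ℝ) / p) := by
  obtain ⟨z, hz⟩ := Nat.modEq_iff_dvd.mp h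
  have hp0 : (p : ℝ) ≠ 0 := by exact_mod_cast hp.ne'
  have hz' : ((b : ℤ) : ℝ) - ((a : ℤ) : ℝ) = ((p : ℤ) : ℝ) * (z : ℝ) := by
    exact_mod_cast congrArg (Int.cast (R := ℝ)) hz
  push_cast at hz'
  have hb : (b : ℝ) / p = (a : ℝ) / p + (z : ℝ) := by
    field_simp
    linarith
  rw [hb, eAdd, eAdd]
  push_cast
  rw [show 2 * (π : ℂ) * I * ((a : ℂ) / (p : ℂ) + (z : ℂ)) =
      2 * π * I * ((a : ℂ) / (p : ℂ)) + (z : ℂ) * (2 * π * I) by ring,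
    Complex.exp_add, Complex.exp_int_mul_two_pi_mul_I, mul_one]

/-- `|Δ₁(x)| = |Δ(x)|` (`Δ(x) = Δ₁(x)e(x)`, (5.6)–(5.7); the tree's `DeltaW D = Δ` at `(𝓛₂, t₀)`). [cite: Zhang2022LandauSiegel, §5 (5.7) p.25] -/
private theorem norm_Delta1_56_eq (D : ℕ) (x : ℝ) :
    ‖Lemma53.Delta1_56 (ell2 D) (t0 D) x‖ = ‖DeltaW D x‖ := by
  rw [DeltaW, Lemma53.Delta57, norm_mul,
    show (2 * π * I * (x : ℂ)) = ((2 * π * x : ℝ) : ℂ) * I by push_cast; ring,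
    Complex.norm_exp_ofReal_mul_I, mul_one]

/-- For `(Dk,p) = (d,p) = 1`: `dl·\overline{Ddk} ≡ l·\overline{Dk} (mod p)` (`\overline{a}·a ≡ 1 (mod p)`), i.e. the
phase `e(mD̄n̄/p)` of u006 depends on `(m,n) = (dl,dk)` only through `(l,k)`. [folklore] -/
private theorem mul_nInv_modEq {p D d k : ℕ} [NeZero p] (hDk : Nat.Coprime (D * k) p)
    (hd : Nat.Coprime d p) (l : ℕ) :
    d * l * nInv p (D * (d * k)) ≡ l * nInv p (D * k) [MOD p] := by
  rw [← ZMod.natCast_eq_natCast_iff]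
  have hDdk : Nat.Coprime (D * (d * k)) p := by
    rw [mul_left_comm]; exact Nat.Coprime.mul_left hd hDk
  have h1 : ((D * k : ℕ) : ZMod p) * ((D * k : ℕ) : ZMod p)⁻¹ = 1 := ZMod.coe_mul_inv_eq_one _ hDk
  have h2 : ((D * (d * k) : ℕ) : ZMod p) * ((D * (d * k) : ℕ) : ZMod p)⁻¹ = 1 :=
    ZMod.coe_mul_inv_eq_one _ hDdk
  push_cast at h1 h2 ⊢
  unfold nInv
  rw [ZMod.natCast_zmod_val, ZMod.natCast_zmod_val]
  push_cast
  calc (d : ZMod p) * l * ((D : ZMod p) * ((d : ZMod p) * k))⁻¹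
      = l * ((d : ZMod p) * ((D : ZMod p) * ((d : ZMod p) * k))⁻¹) * 1 := by ring
    _ = l * ((d : ZMod p) * ((D : ZMod p) * ((d : ZMod p) * k))⁻¹) *
          ((D : ZMod p) * k * ((D : ZMod p) * k)⁻¹) := by rw [h1]
    _ = l * ((D : ZMod p) * k)⁻¹ *
          ((D : ZMod p) * ((d : ZMod p) * k) * ((D : ZMod p) * ((d : ZMod p) * k))⁻¹) := by ring
    _ = l * ((D : ZMod p) * k)⁻¹ := by rw [h2, mul_one]

/-- **The regrouping `d = (m,n)`, `m = dl`, `n = dk` of an absolutely convergent double sum** (abstract form):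
`Σ_m Σ_{1≤n≤N} F(m,n) = Σ_{1≤d≤N} Σ_{1≤k≤N, dk≤N} Σ_{(l,k)=1} F(dl,dk)` (`m = 0` is the pair `(d,l) = (n,0)`). [folklore] -/
private theorem tsum_sum_regroup_gcd (F : ℕ → ℕ → ℂ) (N : ℕ)
    (hS : ∀ n ∈ Finset.Icc 1 N, Summable (fun m => F m n)) :
    ∑' m : ℕ, ∑ n ∈ Finset.Icc 1 N, F m n =
      ∑ d ∈ Finset.Icc 1 N, ∑ k ∈ Finset.Icc 1 N,
        if d * k ≤ N then ∑' l : ℕ, (if Nat.Coprime l k then F (d * l) (d * k) else 0) else 0 := by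
  -- Step 1: the finite `n`-sum commutes with the `m`-series
  rw [Summable.tsum_finsetSum (f := fun n m => F m n) hS]
  -- Step 2: for fixed `n`, partition `m` according to `d = (m,n)` and write `m = dl`
  have h2 : ∀ n ∈ Finset.Icc 1 N, ∑' m : ℕ, F m n =
      ∑ x ∈ n.divisorsAntidiagonal,
        ∑' l : ℕ, (if Nat.Coprime l x.2 then F (x.1 * l) (x.1 * x.2) else 0) := by
    intro n hn
    have hn0 : n ≠ 0 := by have := (Finset.mem_Icc.mp hn).1; omega
    rw [Nat.sum_divisorsAntidiagonal
      (f := fun d k => ∑' l : ℕ, (if Nat.Coprime l k then F (d * l) (d * k) else 0))]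
    have h2a : ∀ m, F m n = ∑ d ∈ n.divisors, if Nat.gcd m n = d then F m n else 0 := by
      intro m
      rw [Finset.sum_ite_eq, if_pos (Nat.mem_divisors.mpr ⟨Nat.gcd_dvd_right m n, hn0⟩)]
    have h2b : ∑' m : ℕ, F m n = ∑' m : ℕ, ∑ d ∈ n.divisors, (if Nat.gcd m n = d then F m n else 0) :=
      tsum_congr h2a
    rw [h2b, Summable.tsum_finsetSum (f := fun d m => if Nat.gcd m n = d then F m n else 0) ?_]
    · refine Finset.sum_congr rfl fun d hd => ?_
      have hdn : d ∣ n := Nat.dvd_of_mem_divisors hd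
      have hd0 : d ≠ 0 := by
        rintro rfl
        exact hn0 (Nat.eq_zero_of_zero_dvd hdn)
      have hgcd : ∀ l, Nat.gcd (d * l) n = d * Nat.gcd l (n / d) := by
        intro l
        conv_lhs => rw [show n = d * (n / d) from (Nat.mul_div_cancel' hdn).symm]
        rw [Nat.gcd_mul_left]
      rw [← (mul_right_injective₀ hd0).tsum_eq ?_]
      · refine tsum_congr fun l => ?_
        rw [Nat.mul_div_cancel' hdn, hgcd l]
        by_cases hl : Nat.Coprime l (n / d)
        · rw [if_pos hl, if_pos (by rw [Nat.Coprime] at hl; rw [hl, mul_one])]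
        · rw [if_neg hl, if_neg ?_]
          intro h
          exact hl ((Nat.mul_eq_left hd0).mp h)
      · intro m hm
        rw [Function.mem_support] at hm
        have h : Nat.gcd m n = d := by
          by_contra h'
          exact hm (if_neg h')
        refine ⟨m / d, ?_⟩
        simp only []
        rw [Nat.mul_div_cancel' (h ▸ Nat.gcd_dvd_left m n)]
    · intro d _
      exact Summable.of_norm_bounded (hS n hn).norm (fun m => by split_ifs <;> simp)
  rw [Finset.sum_congr rfl h2]
  -- Step 3: `Σ_{n≤N} Σ_{dk=n} = Σ_{d≤N} Σ_{k≤N, dk≤N}`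
  set H : ℕ × ℕ → ℂ := fun x =>
    ∑' l : ℕ, (if Nat.Coprime l x.2 then F (x.1 * l) (x.1 * x.2) else 0) with hH
  set S : Finset (ℕ × ℕ) :=
    (Finset.Icc 1 N ×ˢ Finset.Icc 1 N).filter (fun x => x.1 * x.2 ≤ N) with hSdef
  have hmaps : ∀ x ∈ S, x.1 * x.2 ∈ Finset.Icc 1 N := by
    intro x hx
    rw [hSdef, Finset.mem_filter, Finset.mem_product, Finset.mem_Icc, Finset.mem_Icc] at hx
    rw [Finset.mem_Icc]
    exact ⟨Nat.one_le_iff_ne_zero.mpr (Nat.mul_ne_zero (by omega) (by omega)), hx.2⟩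
  have hfib : ∀ n ∈ Finset.Icc 1 N, S.filter (fun x => x.1 * x.2 = n) = n.divisorsAntidiagonal := by
    intro n hn
    obtain ⟨hn1, hnN⟩ := Finset.mem_Icc.mp hn
    ext ⟨a, b⟩
    simp only [hSdef, Finset.mem_filter, Finset.mem_product, Finset.mem_Icc,
      Nat.mem_divisorsAntidiagonal]
    constructor
    · rintro ⟨-, h⟩
      exact ⟨h, by omega⟩
    · rintro ⟨h, -⟩
      have ha : 1 ≤ a := Nat.one_le_iff_ne_zero.mpr (by rintro rfl; simp at h; omega)
      have hb : 1 ≤ b := Nat.one_le_iff_ne_zero.mpr (by rintro rfl; simp at h; omega)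
      have hab : a * b ≤ N := h ▸ hnN
      exact ⟨⟨⟨⟨ha, le_trans (Nat.le_mul_of_pos_right a hb) hab⟩,
        ⟨hb, le_trans (Nat.le_mul_of_pos_left b ha) hab⟩⟩, hab⟩, h⟩
  have h3 : ∑ n ∈ Finset.Icc 1 N, ∑ x ∈ n.divisorsAntidiagonal, H x = ∑ x ∈ S, H x := by
    rw [← Finset.sum_fiberwise_of_maps_to hmaps H]
    exact Finset.sum_congr rfl fun n hn => by rw [hfib n hn]
  rw [h3, hSdef, Finset.sum_filter, Finset.sum_product]

/-- **u006, the second line from the first** (p. 77, tex L3866–L3871): under (14.1) the double sum of the first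
line of u006 converges absolutely (`|κ*(m)| ≤ Bm⁵`, `|Δ₁(x)| = |Δ(x)| ≪ x⁻⁸`, `Section14Summability`), and the
substitution `d = (m,n)`, `m = dl`, `n = dk` regroups it exactly into the second line: `Δ₁(dl/(Dp·dk)) =
Δ₁(l/(Dpk))`, `a*(dk)/(dk) = d⁻¹·a*(dk)/k`, and `e(dl·\overline{D·dk}/p) = e(l·\overline{Dk}/p)` for
`(dDk, p) = 1` (`d, k ≤ N < p`, `p ∤ D`); the pairs with `dk > N` carry `a*(dk) = 0` by (14.2).
[cite: Zhang2022LandauSiegel, §14 u006 p.77, tex L3866–L3871] -/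
theorem sum_u006_regroup {D p N : ℕ} [NeZero p] (hD : 3 ≤ D) (hp : 0 < p)
    (hcop : ∀ j ∈ Finset.Icc 1 N, Nat.Coprime (D * j) p ∧ Nat.Coprime j p)
    {B : ℝ} {κs as : ℕ → ℂ} (hκ : Eq141 B κs) (has : ∀ n : ℕ, N < n → as n = 0) :
    (∑' m : ℕ, ∑ n ∈ Finset.Icc 1 N, κs m * as n / (n : ℂ) *
        Lemma53.Delta1_56 (ell2 D) (t0 D) ((m : ℝ) / ((D : ℝ) * p * n)) *
          eAdd ((m : ℝ) * nInv p (D * n) / p)) =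
      ∑ d ∈ Finset.Icc 1 N, (d : ℂ)⁻¹ * ∑ k ∈ Finset.Icc 1 N,
        as (d * k) / (k : ℂ) * ∑' l : ℕ, if Nat.Coprime l k then
          κs (d * l) * Lemma53.Delta1_56 (ell2 D) (t0 D) ((l : ℝ) / ((D : ℝ) * p * k)) *
            eAdd ((l : ℝ) * nInv p (D * k) / p) else 0 := by
  have hD0 : (0 : ℝ) < D := by exact_mod_cast (show 0 < D by omega)
  have hp0 : (0 : ℝ) < p := by exact_mod_cast hp
  -- absolute convergence of the `m`-series for each `n`
  have hS : ∀ n ∈ Finset.Icc 1 N, Summable (fun m : ℕ => κs m * as n / (n : ℂ) *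
      Lemma53.Delta1_56 (ell2 D) (t0 D) ((m : ℝ) / ((D : ℝ) * p * n)) *
        eAdd ((m : ℝ) * nInv p (D * n) / p)) := by
    intro n hn
    have hn0 : (0 : ℝ) < n := by exact_mod_cast (Finset.mem_Icc.mp hn).1
    have hQ : (0 : ℝ) < (D : ℝ) * p * n := by positivity
    have hs := (summable_kappa_mul_DeltaW hD hκ 1 hQ (g := fun _ => (1 : ℂ)) (G := 1)
      (fun _ => by simp)).norm.mul_left (‖as n‖ / n)
    refine Summable.of_norm_bounded hs (fun m => ?_)
    simp only [one_mul, mul_one]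
    rw [norm_mul, norm_mul, norm_div, norm_mul, norm_eAdd, norm_Delta1_56_eq, norm_mul,
      Complex.norm_natCast]
    exact le_of_eq (by ring)
  rw [tsum_sum_regroup_gcd _ N hS]
  refine Finset.sum_congr rfl fun d hd => ?_
  rw [Finset.mul_sum]
  refine Finset.sum_congr rfl fun k hk => ?_
  obtain ⟨hd1, -⟩ := Finset.mem_Icc.mp hd
  obtain ⟨hk1, -⟩ := Finset.mem_Icc.mp hk
  have hdR : (d : ℝ) ≠ 0 := by exact_mod_cast (show d ≠ 0 by omega)
  have hdC : (d : ℂ) ≠ 0 := by exact_mod_cast (show d ≠ 0 by omega)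
  have hkC : (k : ℂ) ≠ 0 := by exact_mod_cast (show k ≠ 0 by omega)
  have hkR : (k : ℝ) ≠ 0 := by exact_mod_cast (show k ≠ 0 by omega)
  by_cases hdk : d * k ≤ N
  · rw [if_pos hdk]
    simp only [← tsum_mul_left]
    refine tsum_congr fun l => ?_
    by_cases hl : Nat.Coprime l k
    · rw [if_pos hl, if_pos hl]
      have hΔ : Lemma53.Delta1_56 (ell2 D) (t0 D) (((d * l : ℕ) : ℝ) / ((D : ℝ) * p * ((d * k : ℕ) : ℝ))) =
          Lemma53.Delta1_56 (ell2 D) (t0 D) ((l : ℝ) / ((D : ℝ) * p * k)) := by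
        congr 1
        push_cast
        field_simp
      have he : eAdd (((d * l : ℕ) : ℝ) * (nInv p (D * (d * k)) : ℝ) / p) =
          eAdd ((l : ℝ) * (nInv p (D * k) : ℝ) / p) := by
        rw [show ((d * l : ℕ) : ℝ) * (nInv p (D * (d * k)) : ℝ) =
            ((d * l * nInv p (D * (d * k)) : ℕ) : ℝ) by push_cast; ring,
          show (l : ℝ) * (nInv p (D * k) : ℝ) = ((l * nInv p (D * k) : ℕ) : ℝ) by push_cast; ring]
        exact eAdd_div_eq_of_modEq hp (mul_nInv_modEq (hcop k hk).1 (hcop d hd).2 l)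
      rw [hΔ, he]
      push_cast
      field_simp
    · rw [if_neg hl, if_neg hl, mul_zero, mul_zero]
  · rw [if_neg hdk, has (d * k) (by omega)]
    simp

/-- `Z22:§14.u006` EDGE: **the second line of u006 follows from the first** (p. 77) — for `D` large the
substitution `d = (m,n)`, `m = dl`, `n = dk` is an exact identity between the two main terms
(`sum_u006_regroup`; `(p, Dk) = 1` for `k ≤ 2P₄ < P < p`, `Section14GaussSums`), so the error term
`O(PT^{−c})` is inherited unchanged (same `c`, `C`).
[cite: Zhang2022LandauSiegel, §14 u006 p.77, tex L3866–L3871] -/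
theorem step14u006b_of_u006a (h : Step14u006a) : Step14u006b := by
  intro B
  obtain ⟨c, hc, C, D₀, hD₀⟩ := h B
  obtain ⟨D₁, hD₁⟩ := exists_two_mul_P4_le_bigP
  refine ⟨c, hc, C, max D₀ (max D₁ 3), fun D _ χ hD hq hprim hA p hp κs as h1 h2 => ?_⟩
  have hD0 : D₀ ≤ D := le_trans (le_max_left _ _) hD
  have hD1 : D₁ ≤ D := le_trans (le_trans (le_max_left _ _) (le_max_right _ _)) hD
  have hD3 : 3 ≤ D := le_trans (le_trans (le_max_right _ _) (le_max_right _ _)) hD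
  have key := hD₀ D χ hD0 hq hprim hA p hp κs as h1 h2
  have hpr : p.Prime := (Finset.mem_filter.mp hp).2
  haveI : NeZero p := ⟨hpr.ne_zero⟩
  have hcop : ∀ j ∈ Finset.Icc 1 ⌊2 * P4 D⌋₊, Nat.Coprime (D * j) p ∧ Nat.Coprime j p := by
    intro j hj
    have h := (coprime_of_mem_primeWindow_of_le hD₁ hD1 hD3 hp hj).symm
    exact ⟨h, Nat.Coprime.coprime_mul_left h⟩
  have has : ∀ n : ℕ, ⌊2 * P4 D⌋₊ < n → as n = 0 := fun n hn => h2.2 n (Nat.lt_of_floor_lt hn)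
  rw [sum_u006_regroup hD3 hpr.pos hcop h1 has] at key
  exact key

end Literature.NumberTheory.LFunctions.Zhang2022.Typed.Sec14
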